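import Mathlib
import HarnessLib
import HarnessLib.Audit
import Summits.AnomalousDissipation.Statement
import HarnessLib.Audit.Status.Attr

/-!
Route: DopplerClock

DORMANT since 2026-08-25T08:08:37Z (reconciler: no traction for 7.5 d (last activity item-evidence-added at 2026-08-17T19:05:35Z); parked, not closed — `ledger route dormant route-AnomalousDissipation-DopplerClock --off` to reactivate) — unstaffed, not closed; items shared with open routes are served there. `ledger route dormant <id> --off` reactivates.

# Route DopplerClock — frozen clock — a swept Doppler pair of Stokes modes resurrects the clocked
Kolmogorov milestone inside the steady summit

RESURRECTION (lens resurrect) of the retired milestone route ClockedKolmogorov (card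
inertia-limited-clock-s03-quadrature-stress, graded
new-combination; retired 2026-08-15 only because its Assembly ended in the time-periodic statement
S03). The clock is INTERNALISED by the one
exact clock a steadily forced flow on T³ owns — its conserved momentum. Force = a PAIR of Stokes
modes with opposite Doppler shift,
f(x) = F sin(2πm x₁) cos(2πn x₂) e₀ (smooth, div-free, mean-zero, steady, ν-independent; shell m²+n²
≥ 2), data of momentum V e₂. In the
fluid frame y = x − Vt e₂ the force reads F sin(2πm y₁) cos(2πn y₂ + 2πnV t) e₀: ClockedKolmogorov's
standing clocked shear with a
spanwise phase ramp. It suffices to show X = DopplerZerothLaw: for SOME F, V, m, n there are ν_j → 0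
and global Leray–Hopf solutions of
NS_{ν_j} with this force and data of momentum V e₂ whose limsup-mean energies are bounded and
limsup-mean dissipations ≥ ε > 0 — literally
the summit's clauses for one admissible force (the summit leaves the data free). X is reached from
two cruxes: C1 QuadratureStressFloor
(∃: a no-leak drift family whose fluctuation Reynolds stress works at an O(1) mean rate on the
QUADRATURE streak pattern Ψ_s — energy not
assumed) and C2 InjectionControlsEnergy (∀: no infrared pile-up — mean energy ≤ C(1 + mean
injection) for every drift-V Leray–Hopf flow
of this force), through the exact DopplerWorkIdentity (injection = (F/2πnV)·(−Λ⟨T_s⟩ + O(ν))).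
Lean: `∃ (F V : ℝ) (m n : ℕ), 0 < F ∧ 0 < V ∧ 0 < m ∧ 0 < n ∧ ∃ (ν : ℕ → ℝ) (u₀ : ℕ → UnitAddTorus
(Fin 3) → EuclideanSpace ℝ (Fin 3)) (u : ℕ → ℝ → UnitAddTorus (Fin 3) → EuclideanSpace ℝ (Fin 3)),
(∀ j, 0 < ν j) ∧ Filter.Tendsto ν Filter.atTop (nhds 0) ∧ (∀ j,
Literature.Analysis.FluidPDE.Torus.IsGlobalLerayHopf (ν j) (fun _ => (fun (x : UnitAddTorus (Fin 3))
=> (F * (UnitAddTorus.mFourier (Pi.single (1 : Fin 3) (m : ℤ)) x).im * (UnitAddTorus.mFourier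
(Pi.single (2 : Fin 3) (n : ℤ)) x).re) • EuclideanSpace.single (0 : Fin 3) (1 : ℝ))) (u₀ j) (u j)) ∧
(∀ j, ∫ x, u₀ j x = V • EuclideanSpace.single (2 : Fin 3) (1 : ℝ)) ∧ (∃ E : ℝ, ∀ j,
Literature.Analysis.FluidPDE.meanEnergy (u j) ≤ E) ∧ ∃ ε : ℝ, 0 < ε ∧ ∀ j, ε ≤
Literature.Analysis.FluidPDE.meanDissipation (ν j) (u j)`

## Assembly
Deciding theorem (glue.lean, elaborates rc 0): closes : QuadratureStressFloor →
InjectionControlsEnergy → DopplerWorkIdentity → ForceAdmissible →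
CruxesGiveTarget → AnomalousDissipation — CruxesGiveTarget turns the two cruxes and the identity
into X, and closes itself PROVES X → summit
(unpack X, repack `Literature.Turb.ZerothLaw` with f := F sin cos e₀ and the three admissibility
facts; the momentum clause is dropped).
Both cruxes are load-bearing; LaminarStreaks and LongitudinalClassQuiet are design-rule supports
(not in closes).

Rationale: WHY THIS LINE. ClockedKolmogorov's lever (BrueDeLellis2023 Q2.1/2.2; Cheskidov2023 Thm 1.3 is the
nearest theorem, with ν-DEPENDENT periodic forces) was
that a KNOWN external phase makes the zeroth law one-sided: inertia, not viscosity, bounds the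
driven flow (exact laminar state of energy
≤ F²/ω² for all ν) and an exact quadrature identity turns injection into the correlation of ONE
quadratic statistic with the clock. A
Galilean boost (momentum is exactly conserved for mean-zero forces; FoiasManleyRosaTemam2001 Ch. II;
the tree's swept Marchioro states
`Literature.Barriers.AnomalousDissipation.marchioroSweptState`) freezes that clock into the steady
summit: the two Stokes modes (0,m,±n)e₀
acquire opposite Doppler shifts ∓2πnV, so the drifting fluid sees the standing oscillating shear;
the laminar response is an explicit
inertia-limited STREAK ARRAY (amplitude ≤ F/(2πnV) for all ν — LaminarStreaks), the identity
survives as a two-mode rotation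
(DopplerWorkIdentity: injection = production of the fluctuation on the frozen limiting streak
profile U_∞ = (F/2πnV) sin 2πm x₁ sin 2πn x₂ e₀),
and the generation mechanism is the best-understood inflectional one in wall turbulence — inviscid
sinuous streak instability (Waleffe1997,
ReddyEtAl1998, AnderssonEtAl2001), here without walls. Imported: Galilean covariance (symmetry),
exact low-mode bookkeeping of weak
solutions (FoiasManleyRosaTemam2001 Ch. V), streak-instability theory; large-scale multiscale theory
(FrischSheSulem1987, DubrulleFrisch1991,
Frisch1995 §9.6.3.2) only to name C2's enemy. What no listed route has: a known phase +
inertia-limited base state + one-coefficient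
identity (ImpulseGrid's drift design is the RESONANT unit-mass corner with a runaway laminar
response and kick identities; WindLine uses
momentum as a continuation axis; CriticalLayer has no drift); what the corpse lacked: an Assembly
reaching `AnomalousDissipation`, and a
design with NO planar invariant sub-dynamics (d·∇curl f ≡ 0 forces d ∥ e₀, and the x₀-invariant
class relaminarises — LongitudinalClassQuiet),
so the planar-condensate escape that threatened ClockedKolmogorov's C2 (its kill criterion k2) is
closed by a lemma, not by advice.

RANKED CRUXES. #0 DopplerZerothLaw (target) — X: for some F, V > 0 and m, n ≥ 1 there are ν_j → 0⁺,
data u₀ⱼ of momentum V e₂ and global Leray–Hopf solutions u_j of NS_{ν_j} forced by f = F sin(2πm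
x₁) cos(2πn x₂) e₀ with sup_j limsup-mean energy < ∞ and limsup-mean dissipation ν_j⟨‖∇u_j‖²⟩ ≥ ε >
0 (the summit's clauses for this force; closes repackages it with ForceAdmissible). (why it might
fail: It is the zeroth law for one pinned force class: sweeping by the drift may decorrelate the
stress from the frozen pattern (injection → 0 at bounded energy, the KAM-wake/dodger regime,
FranzoiMontalto2022), or loud families may need energy → ∞.) [BrueDeLellis2023, Cheskidov2023,
FranzoiMontalto2022, Frenkel1991]
#2 QuadratureStressFloor (crux) — C1 (ClockedKolmogorov's C1 frozen; energy NOT assumed): ∃ F, V >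
0, m, n ≥ 1, one Banach mean Λ, ν_j → 0⁺ and global Leray–Hopf u_j for f with data momentum V e₂,
per-j sup-in-time energy bounds, NO Leray–Hopf leakage in the mean (limsup-mean (f,u_j) ≤
meanDissipation), and a QUADRATURE STRESS FLOOR ε₀ ≤ −Λ⟨T_s(w_j)⟩ for all j, where w = u − V e₂ and
T_s(w) = ∫ w·(w·∇)Ψ_s, Ψ_s = sin 2πm x₁ sin 2πn x₂ e₀: the fluctuation extracts energy from the
frozen limiting streak profile U_∞ = (F/2πnV)Ψ_s at a positive mean rate (production = −(F/2πnV)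
T_s(w)). Advice to witnesses: G := 2πm F/(2πnV)² ≫ 1 (quasi-static clock, laminar streaks far above
the turbulent level √(F/2πm)), m, n ∈ {1,2}, classical/time-periodic witnesses (no-leak free by
energy equality). [difficulty: open-problem] (why it might fail: Sweeping decorrelation: the drift
V∂₂ slides the pattern past the turbulence; if the stress phase-locks to the fluid rather than to
Ψ_s, −Λ⟨T_s⟩ → 0 with O(1) fluctuation energy (dodging; KAM wakes at fast drift,
FranzoiMontalto2022); relaminarisation intervals make the mean floor vanish.) [Frenkel1991,
Waleffe1997, AnderssonEtAl2001, FranzoiMontalto2022, JensenSumerFredse1989, Cheskidov2023]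
#3 InjectionControlsEnergy (crux) — C2 (NO INFRARED PILE-UP for the swept pair; replaces
ClockedKolmogorov's C2 'loud families stay bounded'): for all F, V > 0, m, n ≥ 1 there is C =
C(F,V,m,n) such that for every ν > 0 and EVERY global Leray–Hopf solution u of NS_ν forced by f with
data momentum exactly V e₂: meanEnergy u ≤ C·(1 + limsup-mean (f,u)). Since |(f,u(t))| ≤
(F/2)‖u(t)‖₂, this yields a ν-UNIFORM energy bound for every drift-V family (quadratic inequality),
in particular for C1's. Momentum must be pinned (else Galilean data refute it, cf. negatives
GPEnergyCeiling). Physically: 3-D turbulence fed at shell κ = 2π(m²+n²)^½ stores no more than O(1 +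
W) energy below κ. [difficulty: XL] (why it might fail: Large-scale negative-eddy-viscosity/AKA-type
instability of the streak array (Frenkel1991; FrischSheSulem1987, DubrulleFrisch1991; drift breaks
parity) may pump gravest modes into a slowly dissipating coherent flow storing energy ≫ injection (a
3-D condensate, AlexakisBiferale2018); false in 2-D.) [Frenkel1991, FrenkelZhang1998,
FrischSheSulem1987, DubrulleFrisch1991, AlexakisBiferale2018, GalletYoung2013]
#9 ForceAdmissible (support) — for all F, m, n the force x ↦ F sin(2πm x₁) cos(2πn x₂) e₀ is smooth
(product of characters), divergence free (its only component does not depend on x₀) and mean zero.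
~80 lines (Torus.isSmooth_mFourier, stokesMode lemmas of FrustratedForcesGPEnergyCeilingRefutation).
[difficulty: provable-now] [FoiasManleyRosaTemam2001]
#9 LaminarStreaks (support) — THE INERTIA-LIMITED BASE STATE (ClockedKolmogorov's
OscillatingKolmogorovLaminar, frozen): for V, ν > 0, n ≥ 1, u_L = V e₂ + sin(2πm x₁)[a cos 2πn x₂ +
b sin 2πn x₂] e₀ with a = Fνκ²/D, b = FV(2πn)/D, D = V²(2πn)² + ν²κ⁴, κ² = 4π²(m²+n²), pressure 0,
is a classical steady solution on ℝ × T³ ((u·∇)u = V∂₂U e₀; V∂₂U = νΔU + f), has momentum V e₂ and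
kinetic energy ½(V² + (a²+b²)/4) ≤ V²/2 + F²/(8V²(2πn)²) UNIFORMLY IN ν (a² + b² = F²/D); as ν → 0,
U → U_∞ = (F/2πnV) Ψ_s. Verified numerically by the planner (residual 4·10⁻⁷, energy identity
exact). ~250 lines; cf. marchioroDriftState/marchioroSweptState in
Literature.Barriers.AnomalousDissipation.GravestModeLaminarAttractorSwept. [difficulty:
provable-now] [Frenkel1991, FoiasManleyRosaTemam2001]
#9 DopplerWorkIdentity (support) — TWO-MODE ROTATION IDENTITY (ClockedKolmogorov's
QuadratureWorkIdentity, frozen): for every Banach mean Λ, V, ν > 0, n ≥ 1 and every global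
Leray–Hopf u for f with data momentum V e₂ and sup-in-time energy bound: Λ⟨(f,u)⟩ = (F/(V·2πn))·(νκ²
Λ⟨(Ψ_s,u)⟩ − Λ⟨T_s(w)⟩). Proof plan (~400 lines): test the weak formulation with the steady div-free
fields Ψ_c = sin cos e₀ and Ψ_s = sin sin e₀ (IsLerayHopfOn.integral_inner_eq_add_setIntegral as in
AlexakisDoeringProofs.amplitude_mul_eq_of_isGlobalLerayHopf; momentum conservation
Torus.IsGlobalLerayHopf.integral_inner_const_eq): with A = (u,Ψ_c), B = (u,Ψ_s), V∂₂Ψ_c = −2πnV Ψ_s,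
V∂₂Ψ_s = 2πnV Ψ_c, ΔΨ = −κ²Ψ, (f,Ψ_c) = F/4, (f,Ψ_s) = 0: B is absolutely continuous with B' =
T_s(w) + 2πnV A − νκ²B; Cesàro-average, boundary terms o(1) by the sup-energy bound, apply Λ
(linear, kills null sequences): 2πnV Λ⟨A⟩ = νκ²Λ⟨B⟩ − Λ⟨T_s⟩; injection (f,u) = F·A. [difficulty:
provable-now] [FoiasManleyRosaTemam2001, AlexakisDoering2006PLA, DoeringFoias2002]
#9 LongitudinalClassQuiet (support) — DESIGN RULE (ClockedKolmogorov's PlanarStageBound, now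
structural): the only translation-invariant sub-dynamics of this force is x₀-invariance (d·∇ curl f
≡ 0 forces d ∥ e₀ when F ≠ 0, m, n ≥ 1; x₁- or x₂-invariant solutions do not exist), and it is
QUIET: every x₀-invariant classical solution on [0,∞) with momentum V e₂ and bounded energy has
meanDissipation ≤ νκ²F²/(4V²(2πn)²) (= the laminar bound). Proof plan: the cross-plane field
(u₁,u₂)(t,x₁,x₂) solves UNFORCED 2-D Navier–Stokes, hence → V e₂ exponentially with ∫₀^∞‖∇v‖² < ∞;
u₀ is a forced scalar advected by it and relaxes to the laminar streaks in L² with square-integrable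
gradient error; Cesàro means inherit the laminar values. ~600 lines. [difficulty: M]
[AlexakisDoering2006PLA, Marchioro1986, BardosTitiWiedemann2012]
#9 CruxesGiveTarget (support) — GLUE C1 → C2 → DopplerWorkIdentity → X (~300 lines of
limsup/Banach-mean bookkeeping): take F,V,m,n,Λ and the family from C1; C2 gives E_j :=
meanEnergy(u_j) ≤ C(1 + W̄_j) with W̄_j = limsup-mean (f,u_j) ≤ (F/2)·√E_j (Cauchy–Schwarz in space,
Jensen in time, ‖f‖₂ = F/2), so E_j ≤ E* uniformly (quadratic inequality); the identity gives
Λ⟨(f,u_j)⟩ ≥ (F/2πnV)(ε₀ − ν_jκ²|Λ⟨B_j⟩|) with |Λ⟨B_j⟩| ≤ ½√E* (GeneralizedLimit.le_limsup /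
liminf_le, ‖Ψ_s‖₂ = ½), hence ≥ ε := Fε₀/(4πnV) for j ≥ J; no-leak and Λ ≤ limsup give
meanDissipation ≥ ε for j ≥ J; reindex j ↦ j + J (Filter.tendsto_add_atTop_iff_nat). [difficulty:
provable-now] [FoiasManleyRosaTemam2001, DoeringFoias2002]

TWO-LAYER PLAN. Foreseen glued splits (not filed now): C1 ⇐ CoherentDriftWitness (time-periodic
classical solutions in the lab frame with the stress floor)
→ ClassicalNoLeak (classical ⇒ global LH + energy equality, provable) → C1; C2 ⇐ CondensateFree
(energy below shell κ ≤ C(1 + energy at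
and above κ)) → HighShellBounded (energy ≥ κ ≤ C'(1 + injection)) → C2. A ν-uniform
linear-instability statement for LaminarStreaks
(2-D eigenproblem in (x₁,x₂) with drift V∂₂, streamwise wavenumber 2πl) is the natural first child
of C1's witness line.

KILL CRITERIA. (k1) SWEEP DECORRELATION proved — along every bounded-energy drift-V Leray–Hopf
family of this force class −Λ⟨T_s(w_j)⟩ → 0 (the frozen
twin of ClockedKolmogorov's ClockDecorrelation; a proof must use the exact
steadiness/ν-independence, barrier ForceRobust) ⇒ with C2 it
refutes C1: close `refuted:QuadratureStressFloor`. (k2) An explicit drift-V Leray–Hopf family with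
bounded injection and meanEnergy → ∞
(3-D condensate) refutes C2: repair = restate C2 under C1's stress-floor hypothesis
(ClockedKolmogorov's original C2) or fold the energy
bound into C1 (thinner route, needs-human 1-crux); if the runaway family is itself loud the route
survives as X directly. (k3) ν-uniform
global stability of LaminarStreaks for ALL (F,V,m,n) (a sweeping-laminarisation theorem) kills the
class. (k4) Correlation.EnergyUnboundedNeg-type
universal negatives proved elsewhere moot every positive route. (k5) kit evidence: −⟨T_s⟩ ∝ ν^a at
fixed design over ν = 2⁻⁶…2⁻¹¹ ⇒ dormant.

NOT DECOMPOSED YET. No split of C1 into "ν-uniform streak instability" + "mixing/residence floor"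
(the cycling loophole separates rates from levels; card
cycling-loophole-rate-vs-level); no Floquet/KAM item for the fast-clock regime G ≲ 1 (quiet by
averaging, FranzoiMontalto2022 — advice,
not a clause); no statistical-solution variant; no regime split in (m,n); the negative twin
SweepDecorrelation is a kill criterion, not an
item (it would not be a binder of closes). Constants C(F,V,m,n) of C2 and the spectral split behind
it are layer-2.

CHEAPEST FALSIFIER. (a) Linear stability of the frozen streak array u_L(ν) with drift
(Fourier–Galerkin in (x₁,x₂), streamwise wavenumber 2πl, l = 1,2;
m = n = 1 and (m,n) = (2,1); G = 2πmF/(2πnV)² ∈ {4,16,64}; ν = 2⁻⁴…2⁻¹⁰): if the leading growth rate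
tends to 0 with ν for every G the
generation mechanism is absent and C1 is suspect-false; if it saturates at σ₀(G) > 0 the Attack's
first lemma is certified (interval
Newton on the leading mode). Not run by the planner (no numpy on the hub; to be filed as ONE kit job
by the first refuter/prover).
(b) DNS in the drift frame (pseudo-spectral 64³–128³, same designs, ν = 2⁻⁶…2⁻¹¹, 10³ clock
periods): plateau of −⟨T_s⟩ and of ε vs ν,
and meanEnergy vs injection (C2). (c) Lookup: a printed sweeping-laminarisation or
large-scale-condensate result for spatially periodic
3-D forcing with uniform mean flow (searched: none found; 2-D condensates GalletYoung2013 excluded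
by LongitudinalClassQuiet's companion
fact that no planar invariant class exists).

NUMBERS. Laminar streak amplitude A = F/√(V²(2πn)² + ν²κ⁴) ≤ F/(2πnV) (all ν); laminar energy ≤ V²/2
+ F²/(8V²(2πn)²); laminar injection
F²νκ²/(4D) → 0 and dissipation νκ²(a²+b²)/4 → 0 (quiet, reactive: B-heavy response). Clock ω = 2πnV;
detuning number G = 2πm·F/ω²
(quasi-static iff G ≫ 1, ClockedKolmogorov's advice "Fk/ω² large"); expected turbulent level u' ~
√(F/2πm) ≪ A = √G·u'·… for G ≫ 1;
K41-consistent injection ε ~ F^{3/2}(2πm)^{-1/2} independent of V, ν. Sweeping ceiling (card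
sweeping-ceiling-injection-bound): injection
≤ C(f)(E+1)/V — harmless for small V. ‖f‖₂ = F/2, ‖Ψ_s‖₂ = ‖Ψ_c‖₂ = ½, (f,Ψ_c) = F/4, (f,Ψ_s) = 0.
Items at open: 9 (target, 2 cruxes,
5 supports, assembly).

DEFINITION REQUESTS. None: every constant exists (UnitAddTorus.mFourier, EuclideanSpace.single,
Literature.Analysis.FluidPDE.Torus.IsGlobalLerayHopf,
Literature.Analysis.FluidPDE.{meanEnergy, meanDissipation, longTimeAvgSup,
GeneralizedLimit.longTimeAvg},
Literature.Analysis.FunctionSpaces.Torus.{IsSmooth, IsDivFree, HasZeroMean, convect, kineticEnergy,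
IsClassicalNSSolutionOn}; Sketch.lean rc 0).
Bib keys added this session: FrischSheSulem1987, AnderssonEtAl2001, ReddyEtAl1998,
AlexakisBiferale2018, SturmanOttinoWiggins2006.

CONE FACTS (route-repair, 2026-08-17). Gate deps cone at rev 0: 54 project constants, 0 unproved,
staffable YES (deciding theorem native-OK;
exempt as summit-grade definitions: meanEnergy, meanDissipation, Torus.IsGlobalLerayHopf,
Torus.IsSmooth/IsDivFree/HasZeroMean). The unproved
Prop constants a MODULE-level import-cone count sees — Literature.Analysis.FluidPDE.ZerothLawNeg
(@[conjecture]; the negative side of the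
summit), Literature.Analysis.FluidPDE.ZerothLawTimePeriodic (@[conjecture]; turb.S03, time-periodic
force),
Literature.Analysis.FluidPDE.cheskidov_time_periodic_anomaly (Cheskidov2023 Thm 1.3, cite-only,
ν-DEPENDENT forces; one leaf
`acm_building_blocks` from discharge, see
Literature/Analysis/FluidPDE/CheskidovTimePeriodicAnomaly.lean) — all live in
Literature/Analysis/FluidPDE/ZerothLaw.lean, which the sub-problem Statement itself imports (that
file hosts meanEnergy/meanDissipation);
a fourth Prop without `_holds`, Literature.Analysis.FluidPDE.Torus.IsLerayHopfOn.mono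
(LerayHopf.lean; torus twin of the DISCHARGED
whole-space IsLerayHopfOn.mono_holds), rides in the same way through the Statement's LerayHopf
import. This route adds NO import of its
own, and no item and not `closes` mentions any of the four (decl-cone leaves:
GeneralizedLimit(.longTimeAvg), longTimeAvgSup, meanEnergy,
meanDissipation, Torus.IsGlobalLerayHopf, Torus.{IsSmooth, IsDivFree, HasZeroMean, convect,
kineticEnergy}; items further use only the
DEFINITIONS Torus.IsClassicalNSSolutionOn, UnitAddTorus.mFourier, EuclideanSpace.single) — so none
is a hypothesis or debt of this line:
needs-fact: NONE; nothing to drop, nothing to restate (same finding as the WindLine and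
BoussinesqOctaves cone repairs). Every other Prop
fact in the 21-module closure (FlatTorus, TorusCalculus, TorusSobolevNorm, TorusFluidGlue,
SobolevDomain, VectorCalculus,
ClassicalSolution, WeakSolution, LerayHopf, TurbWave0, ZerothLaw) has its `_holds` in tree (checked
decl by decl, 2026-08-17).

Novelty: Searches (2026-08-17): corpus of the lens (7 own-closed routes, 2001 SUMMIT.md ×2), all 38 open
route theses (current_theses.json), the 34
open + 101 closed idea cards grepped for drift/Galilean/travelling/Doppler/streak/clock (hits read
in full: frozen-clocks-drift-as-time
[closed:known], crossflow-kolmogorov-stress-floor-aka [variant],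
galilean-drift-sweep-bridge-kam-wakes [variant], inertia-limited-clock-s03-
quadrature-stress [new-combination, routed→retired], cellular-conveyor-dodgers-kolmogorov-vwi,
approach-from-the-wind, streamwise-transfer-
necessary-ql-shear-nogo), `ledger negatives --problem AnomalousDissipation` (6 entries), lens files
oqh/frontier.json (60 rows, none on
ν-independent periodic/travelling forcing), `lit vsearch` ×6 (books only: Frisch1995 §9.6.3.2
pp.183–185 AKA/negative eddy viscosity;
Drazin2002), `lit galaxy search --star all` "oscillating Kolmogorov flow" (1 irrelevant), "streak
instability" (22: Waleffe ECS/SSP notes,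
AnderssonEtAl2001-type breakdown papers), "traveling wave forcing"/"travelling-wave body force" (0);
`lit search` local/openalex/arxiv/s2/zbmath
all UNAVAILABLE this session (searchd connection reset; HTTP 429) — logged, to be re-run by the
novelty audit.
Nearest prior art found: the corpse ClockedKolmogorov + its card (doi:10.1017/s0022112089002302,
arXiv:2311.04182 Thm 1.3 = ν-dependent
periodic forces; Frenkel1991 doi:10.1063/1.857951 oscillating Kolmogorov flow stability); card
frozen-clocks-drift-as-time closed as KNOWN
kine  [refs: 10.1017/s0022112089002302, 10.1063/1.857951, 2311.04182, doi:10.1017/s0022112089002302, doi:10.1063/1.857951, Frisch1995, Drazin2002, AnderssonEtAl2001, Frenkel1991, SturmanOttinoWiggins2006, FranzoiMontalto2022, Waleffe1997, ReddyEtAl1998]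

Barriers (technique_class: galilean-clock inertia-limited-base quadrature-identity): - technique_class: galilean-clock inertia-limited-base quadrature-identity
- Literature.Barriers.AnomalousDissipation.Marchioro1986_globalAttraction: first-shell, 2-D,
zero-momentum laminar rigidity; here the force sits in shell m²+n² ≥ 2, the setting is 3-D, momentum
is V e₂ ≠ 0 and the energy method fails for ν ≪ F/(2πnV·κ); its swept companion
(GravestModeLaminarAttractorSwept) is the 2-D one-mode ancestor of LaminarStreaks — quiet, as every
laminar state here; the bet is that the streak array, unlike Marchioro's mode, is ν-uniformly
unstable (kill criterion k3 is exactly a Marchioro theorem for this class).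
- Literature.Barriers.AnomalousDissipation.AlexakisDoering2006_energyDissipationBound: ε ≲ Re^{-1/2}
for planar (x₃-invariant) dynamics, any time dependence; EVADED STRUCTURALLY — this force admits no
x₁- or x₂-invariant solutions and the x₀-invariant class relaminarises (LongitudinalClassQuiet), so
no planar stage can carry or fake the floor; witnesses are genuinely 3-D by necessity, not by
advice.
- Literature.Barriers.AnomalousDissipation.BardosTitiWiedemann2012_thm5: viscosity selects the
conservative shear flow from shear DATA; LaminarStreaks is unidirectional-plus-drift and indeed
quiet; C1's witnesses are not of shear form and nothing is inferred from roughness of data.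
- Literature.Barriers.AnomalousDissipation.Cheskidov2023_thm13_not_forceRobustNoAnomaly: blocks
force-robust NO-anomaly proofs; C1 is witness-side, C2 is an energy CEILING (not a no-anomaly claim

History (route lifecycle, newest last):
- 2026-08-25T08:08:37Z · DORMANT — reconciler: no traction for 7.5 d (last activity item-evidence-added at 2026-08-17T19:05:35Z); parked, not closed — `ledger route dormant route-AnomalousDissipa (operator:999:3737857)

sub-problem: AnomalousDissipation · status: dormant · opened planner-plan-lens3-AnomalousDissipation-resurrect-0 2026-08-17T02:21:39Z · rev 1 · ledger route-AnomalousDissipation-DopplerClock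
GENERATED by the gate from the ledger (D-0016/17). Provers cite these decls: `theorem foo : Summit.AnomalousDissipation.AnomalousDissipation.Theses.DopplerClock.<Decl> := …` in Summits/AnomalousDissipation/AnomalousDissipation/Theorems/<Name>.lean.
-/

namespace Summit.AnomalousDissipation.AnomalousDissipation.Theses.DopplerClock

open scoped BigOperators Topology Manifold Classical MeasureTheory ProbabilityTheory Matrix InnerProductSpace ComplexConjugate ContinuousMap
open Filter Set Function TopologicalSpace MeasureTheory

attribute [summit_statement] _root_.AnomalousDissipation

open Literature.Turb

/-- item stmt-AnomalousDissipation-18128 · target · rank 0 · open · by planner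
why it might fail: It is the zeroth law for one pinned force class: sweeping by the drift may decorrelate the stress from the frozen pattern (injection → 0 at bounded energy, the KAM-wake/dodger regime, FranzoiMontalto2022), or loud families may need energy → ∞.
sources: BrueDeLellis2023, Cheskidov2023, FranzoiMontalto2022, Frenkel1991
[target] X: for some F, V > 0 and m, n ≥ 1 there are ν_j → 0⁺, data u₀ⱼ of momentum V e₂ and global
Leray–Hopf solutions u_j of NS_{ν_j} forced by f = F sin(2πm x₁) cos(2πn x₂) e₀ with sup_j
limsup-mean energy < ∞ and limsup-mean dissipation ν_j⟨‖∇u_j‖²⟩ ≥ ε > 0 (the summit's clauses for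
this force; closes repackages it with ForceAdmissible). -/
@[route_item "route-AnomalousDissipation-DopplerClock"]
def DopplerZerothLaw : Prop :=
  ∃ (F V : ℝ) (m n : ℕ), 0 < F ∧ 0 < V ∧ 0 < m ∧ 0 < n ∧ ∃ (ν : ℕ → ℝ) (u₀ : ℕ → UnitAddTorus (Fin 3) → EuclideanSpace ℝ (Fin 3)) (u : ℕ → ℝ → UnitAddTorus (Fin 3) → EuclideanSpace ℝ (Fin 3)), (∀ j, 0 < ν j) ∧ Filter.Tendsto ν Filter.atTop (nhds 0) ∧ (∀ j, Literature.Analysis.FluidPDE.Torus.IsGlobalLerayHopf (ν j) (fun _ => (fun (x : UnitAddTorus (Fin 3)) => (F * (UnitAddTorus.mFourier (Pi.single (1 : Fin 3) (m : ℤ)) x).im * (UnitAddTorus.mFourier (Pi.single (2 : Fin 3) (n : ℤ)) x).re) • EuclideanSpace.single (0 : Fin 3) (1 : ℝ))) (u₀ j) (u j)) ∧ (∀ j, ∫ x, u₀ j x = V • EuclideanSpace.single (2 : Fin 3) (1 : ℝ)) ∧ (∃ E : ℝ, ∀ j, Literature.Analysis.FluidPDE.meanEnergy (u j) ≤ E)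 ∧ ∃ ε : ℝ, 0 < ε ∧ ∀ j, ε ≤ Literature.Analysis.FluidPDE.meanDissipation (ν j) (u j)

/-- item stmt-AnomalousDissipation-18129 · crux · rank 2 · open · by planner
why it might fail: Sweeping decorrelation: the drift V∂₂ slides the pattern past the turbulence; if the stress phase-locks to the fluid rather than to Ψ_s, −Λ⟨T_s⟩ → 0 with O(1) fluctuation energy (dodging; KAM wakes at fast drift, FranzoiMontalto2022); relaminarisation intervals make the mean floor vanish.
sources: Frenkel1991, Waleffe1997, AnderssonEtAl2001, FranzoiMontalto2022, JensenSumerFredse1989, Cheskidov2023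
[crux] C1 (ClockedKolmogorov's C1 frozen; energy NOT assumed): ∃ F, V > 0, m, n ≥ 1, one Banach mean
Λ, ν_j → 0⁺ and global Leray–Hopf u_j for f with data momentum V e₂, per-j sup-in-time energy
bounds, NO Leray–Hopf leakage in the mean (limsup-mean (f,u_j) ≤ meanDissipation), and a QUADRATURE
STRESS FLOOR ε₀ ≤ −Λ⟨T_s(w_j)⟩ for all j, where w = u − V e₂ and T_s(w) = ∫ w·(w·∇)Ψ_s, Ψ_s = sin
2πm x₁ sin 2πn x₂ e₀: the fluctuation extracts energy from the frozen limiting streak profile U_∞ =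
(F/2πnV)Ψ_s at a positive mean rate (production = −(F/2πnV) T_s(w)). Advice to witnesses: G := 2πm
F/(2πnV)² ≫ 1 (quasi-static clock, laminar streaks far above the turbulent level √(F/2πm)), m, n ∈
{1,2}, classical/time-periodic witnesses (no-leak free by energy equality). [difficulty:
open-problem] -/
@[route_item "route-AnomalousDissipation-DopplerClock", crux]
def QuadratureStressFloor : Prop :=
  ∃ (F V : ℝ) (m n : ℕ), 0 < F ∧ 0 < V ∧ 0 < m ∧ 0 < n ∧ ∃ (Λ : Literature.Analysis.FluidPDE.GeneralizedLimit), ∃ (ν : ℕ → ℝ) (u₀ : ℕ → UnitAddTorus (Fin 3) → EuclideanSpace ℝ (Fin 3)) (u : ℕ → ℝ → UnitAddTorus (Fin 3) → EuclideanSpace ℝ (Fin 3)), (∀ j, 0 < ν j) ∧ Filter.Tendsto ν Filter.atTop (nhds 0) ∧ (∀ j, Literature.Analysis.FluidPDE.Torus.IsGlobalLerayHopf (ν j) (fun _ => (fun (x : UnitAddTorus (Fin 3)) => (F * (UnitAddTorus.mFourier (Pi.single (1 : Fin 3) (m : ℤ)) x).im * (UnitAddTorus.mFourier (Pi.single (2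 : Fin 3) (n : ℤ)) x).re) • EuclideanSpace.single (0 : Fin 3) (1 : ℝ))) (u₀ j) (u j)) ∧ (∀ j, ∫ x, u₀ j x = V • EuclideanSpace.single (2 : Fin 3) (1 : ℝ)) ∧ (∀ j, ∃ C : ℝ, ∀ t : ℝ, 0 ≤ t → Literature.Analysis.FunctionSpaces.Torus.kineticEnergy (u j t) ≤ C) ∧ (∀ j, Literature.Analysis.FluidPDE.longTimeAvgSup (fun t => ∫ x, inner ℝ ((F * (UnitAddTorus.mFourier (Pi.single (1 : Fin 3) (m : ℤ)) x).im * (UnitAddTorus.mFourier (Pi.single (2 : Fin 3) (n : ℤ)) x).re) • EuclideanSpace.single (0 : Fin 3) (1 : ℝ)) (u j t x)) ≤ Literature.Analysis.FluidPDE.meanDissipation (ν j) (u j)) ∧ ∃ ε₀ : ℝ, 0 < ε₀ ∧ ∀ j, ε₀ ≤ -Λ.longTimeAvg (fun t => ∫ x, inner ℝ (u j t x - V • EuclideanSpace.single (2 : Fin 3) (1 : ℝ)) (Literature.Analysis.FunctionSpaces.Torus.convect (fun y => u j t y - V • EuclideanSpace.single (2 : Fin 3) (1 : ℝ)) (fun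 (y : UnitAddTorus (Fin 3)) => ((UnitAddTorus.mFourier (Pi.single (1 : Fin 3) (m : ℤ)) y).im * (UnitAddTorus.mFourier (Pi.single (2 : Fin 3) (n : ℤ)) y).im) • EuclideanSpace.single (0 : Fin 3) (1 : ℝ)) x))

/-- item stmt-AnomalousDissipation-18130 · crux · rank 3 · open · by planner
why it might fail: Large-scale negative-eddy-viscosity/AKA-type instability of the streak array (Frenkel1991; FrischSheSulem1987, DubrulleFrisch1991; drift breaks parity) may pump gravest modes into a slowly dissipating coherent flow storing energy ≫ injection (a 3-D condensate, AlexakisBiferale2018); false in 2-D.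
sources: Frenkel1991, FrenkelZhang1998, FrischSheSulem1987, DubrulleFrisch1991, AlexakisBiferale2018, GalletYoung2013
[crux] C2 (NO INFRARED PILE-UP for the swept pair; replaces ClockedKolmogorov's C2 'loud families
stay bounded'): for all F, V > 0, m, n ≥ 1 there is C = C(F,V,m,n) such that for every ν > 0 and
EVERY global Leray–Hopf solution u of NS_ν forced by f with data momentum exactly V e₂: meanEnergy u
≤ C·(1 + limsup-mean (f,u)). Since |(f,u(t))| ≤ (F/2)‖u(t)‖₂, this yields a ν-UNIFORM energy bound
for every drift-V family (quadratic inequality), in particular for C1's. Momentum must be pinned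
(else Galilean data refute it, cf. negatives GPEnergyCeiling). Physically: 3-D turbulence fed at
shell κ = 2π(m²+n²)^½ stores no more than O(1 + W) energy below κ. [difficulty: XL] -/
@[route_item "route-AnomalousDissipation-DopplerClock", crux]
def InjectionControlsEnergy : Prop :=
  ∀ (F V : ℝ) (m n : ℕ), 0 < F → 0 < V → 0 < m → 0 < n → ∃ C : ℝ, ∀ (ν : ℝ) (u₀ : UnitAddTorus (Fin 3) → EuclideanSpace ℝ (Fin 3)) (u : ℝ → UnitAddTorus (Fin 3) → EuclideanSpace ℝ (Fin 3)), 0 < ν → Literature.Analysis.FluidPDE.Torus.IsGlobalLerayHopf ν (fun _ => (fun (x : UnitAddTorus (Fin 3)) => (F * (UnitAddTorus.mFourier (Pi.single (1 : Fin 3) (m : ℤ)) x).im * (UnitAddTorus.mFourier (Pi.single (2 : Fin 3) (n : ℤ)) x).re) • EuclideanSpace.single (0 : Fin 3) (1 : ℝ))) u₀ u → (∫ x, u₀ x = V • EuclideanSpace.single (2 : Fin 3) (1 : ℝ)) → Literature.Analysis.FluidPDE.meanEnergy u ≤ C * (1 + Literature.Analysis.FluidPDE.longTimeAvgSup (fun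 t => ∫ x, inner ℝ ((F * (UnitAddTorus.mFourier (Pi.single (1 : Fin 3) (m : ℤ)) x).im * (UnitAddTorus.mFourier (Pi.single (2 : Fin 3) (n : ℤ)) x).re) • EuclideanSpace.single (0 : Fin 3) (1 : ℝ)) (u t x)))

/-- item stmt-AnomalousDissipation-18131 · support · rank 9 · closed · proved by Summit.AnomalousDissipation.AnomalousDissipation.Theorems.dopplerClock_forceAdmissible_proof @ a1364c9988f1 (prover) · by planner
sources: FoiasManleyRosaTemam2001
[support] for all F, m, n the force x ↦ F sin(2πm x₁) cos(2πn x₂) e₀ is smooth (product of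
characters), divergence free (its only component does not depend on x₀) and mean zero. ~80 lines
(Torus.isSmooth_mFourier, stokesMode lemmas of FrustratedForcesGPEnergyCeilingRefutation).
[difficulty: provable-now] -/
@[route_item "route-AnomalousDissipation-DopplerClock", crux]
def ForceAdmissible : Prop :=
  ∀ (F : ℝ) (m n : ℕ), Literature.Analysis.FunctionSpaces.Torus.IsSmooth (fun (x : UnitAddTorus (Fin 3)) => (F * (UnitAddTorus.mFourier (Pi.single (1 : Fin 3) (m : ℤ)) x).im * (UnitAddTorus.mFourier (Pi.single (2 : Fin 3) (n : ℤ)) x).re) • EuclideanSpace.single (0 : Fin 3) (1 : ℝ)) ∧ Literature.Analysis.FunctionSpaces.Torus.IsDivFree (fun (x : UnitAddTorus (Fin 3)) => (F * (UnitAddTorus.mFourier (Pi.single (1 : Fin 3) (m : ℤ)) x).im * (UnitAddTorus.mFourier (Pi.single (2 : Fin 3) (n : ℤ)) x).re) • EuclideanSpace.single (0 : Fin 3) (1 : ℝ)) ∧ Literature.Analysis.FunctionSpaces.Torus.HasZeroMean (fun (x : UnitAddTorus (Fin 3)) => (F * (UnitAddTorus.mFourier (Pi.single (1 : Fin 3)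 (m : ℤ)) x).im * (UnitAddTorus.mFourier (Pi.single (2 : Fin 3) (n : ℤ)) x).re) • EuclideanSpace.single (0 : Fin 3) (1 : ℝ))

/-- item stmt-AnomalousDissipation-18132 · support · rank 9 · closed · proved by Summit.AnomalousDissipation.AnomalousDissipation.Theorems.dopplerClock_laminarStreaks_proof @ 79db9ccc92de (prover) · by planner
sources: Frenkel1991, FoiasManleyRosaTemam2001
[support] THE INERTIA-LIMITED BASE STATE (ClockedKolmogorov's OscillatingKolmogorovLaminar, frozen):
for V, ν > 0, n ≥ 1, u_L = V e₂ + sin(2πm x₁)[a cos 2πn x₂ + b sin 2πn x₂] e₀ with a = Fνκ²/D, b =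
FV(2πn)/D, D = V²(2πn)² + ν²κ⁴, κ² = 4π²(m²+n²), pressure 0, is a classical steady solution on ℝ ×
T³ ((u·∇)u = V∂₂U e₀; V∂₂U = νΔU + f), has momentum V e₂ and kinetic energy ½(V² + (a²+b²)/4) ≤ V²/2
+ F²/(8V²(2πn)²) UNIFORMLY IN ν (a² + b² = F²/D); as ν → 0, U → U_∞ = (F/2πnV) Ψ_s. Verified
numerically by the planner (residual 4·10⁻⁷, energy identity exact). ~250 lines; cf.
marchioroDriftState/marchioroSweptState in
Literature.Barriers.AnomalousDissipation.GravestModeLaminarAttractorSwept. [difficulty: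
provable-now] -/
@[route_item "route-AnomalousDissipation-DopplerClock"]
def LaminarStreaks : Prop :=
  ∀ (F V ν : ℝ) (m n : ℕ), 0 < V → 0 < ν → 0 < n → Literature.Analysis.FunctionSpaces.Torus.IsClassicalNSSolutionOn Set.univ ν (fun _ => (fun (x : UnitAddTorus (Fin 3)) => (F * (UnitAddTorus.mFourier (Pi.single (1 : Fin 3) (m : ℤ)) x).im * (UnitAddTorus.mFourier (Pi.single (2 : Fin 3) (n : ℤ)) x).re) • EuclideanSpace.single (0 : Fin 3) (1 : ℝ))) (fun _ => (fun (x : UnitAddTorus (Fin 3)) => V • EuclideanSpace.single (2 : Fin 3) (1 : ℝ) + ((UnitAddTorus.mFourier (Pi.single (1 : Fin 3) (m : ℤ)) x).im * ((F * ν * ((2 * Real.pi) ^ 2 * ((m : ℝ) ^ 2 + (n : ℝ) ^ 2)) / (V ^ 2 * (2 * Real.pi * n) ^ 2 + ν ^ 2 * ((2 * Real.pi) ^ 2 * ((m : ℝ) ^ 2 + (n : ℝ) ^ 2)) ^ 2)) * (UnitAddTorus.mFourier (Pi.single (2 : Fin 3) (n : ℤ)) x).re + (F * V * (2 * Real.pi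 * n) / (V ^ 2 * (2 * Real.pi * n) ^ 2 + ν ^ 2 * ((2 * Real.pi) ^ 2 * ((m : ℝ) ^ 2 + (n : ℝ) ^ 2)) ^ 2)) * (UnitAddTorus.mFourier (Pi.single (2 : Fin 3) (n : ℤ)) x).im)) • EuclideanSpace.single (0 : Fin 3) (1 : ℝ))) (fun _ _ => 0) ∧ (∫ x, (fun (x : UnitAddTorus (Fin 3)) => V • EuclideanSpace.single (2 : Fin 3) (1 : ℝ) + ((UnitAddTorus.mFourier (Pi.single (1 : Fin 3) (m : ℤ)) x).im * ((F * ν * ((2 * Real.pi) ^ 2 * ((m : ℝ) ^ 2 + (n : ℝ) ^ 2)) / (V ^ 2 * (2 * Real.pi * n) ^ 2 + ν ^ 2 * ((2 * Real.pi) ^ 2 * ((m : ℝ) ^ 2 + (n : ℝ) ^ 2)) ^ 2)) * (UnitAddTorus.mFourier (Pi.single (2 : Fin 3) (n : ℤ)) x).re + (F * V * (2 * Real.pi * n) / (V ^ 2 * (2 * Real.pi * n) ^ 2 + ν ^ 2 * ((2 * Real.pi) ^ 2 * ((m : ℝ) ^ 2 + (n : ℝ) ^ 2)) ^ 2)) *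 (UnitAddTorus.mFourier (Pi.single (2 : Fin 3) (n : ℤ)) x).im)) • EuclideanSpace.single (0 : Fin 3) (1 : ℝ)) x = V • EuclideanSpace.single (2 : Fin 3) (1 : ℝ)) ∧ Literature.Analysis.FunctionSpaces.Torus.kineticEnergy (fun (x : UnitAddTorus (Fin 3)) => V • EuclideanSpace.single (2 : Fin 3) (1 : ℝ) + ((UnitAddTorus.mFourier (Pi.single (1 : Fin 3) (m : ℤ)) x).im * ((F * ν * ((2 * Real.pi) ^ 2 * ((m : ℝ) ^ 2 + (n : ℝ) ^ 2)) / (V ^ 2 * (2 * Real.pi * n) ^ 2 + ν ^ 2 * ((2 * Real.pi) ^ 2 * ((m : ℝ) ^ 2 + (n : ℝ) ^ 2)) ^ 2)) * (UnitAddTorus.mFourier (Pi.single (2 : Fin 3) (n : ℤ)) x).re + (F * V * (2 * Real.pi * n) / (V ^ 2 * (2 * Real.pi * n) ^ 2 + ν ^ 2 * ((2 * Real.pi) ^ 2 * ((m : ℝ) ^ 2 + (n : ℝ) ^ 2)) ^ 2)) * (UnitAddTorus.mFourier (Pi.single (2 : Fin 3) (n : ℤ)) x).im)) • EuclideanSpace.single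 (0 : Fin 3) (1 : ℝ)) ≤ V ^ 2 / 2 + F ^ 2 / (8 * V ^ 2 * (2 * Real.pi * n) ^ 2)

/-- item stmt-AnomalousDissipation-18133 · support · rank 9 · closed · proved by Summit.AnomalousDissipation.AnomalousDissipation.Theorems.dopplerWorkIdentity_proof @ 3b3afbea4d37 (prover) · by planner
sources: FoiasManleyRosaTemam2001, AlexakisDoering2006PLA, DoeringFoias2002
[support] TWO-MODE ROTATION IDENTITY (ClockedKolmogorov's QuadratureWorkIdentity, frozen): for every
Banach mean Λ, V, ν > 0, n ≥ 1 and every global Leray–Hopf u for f with data momentum V e₂ and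
sup-in-time energy bound: Λ⟨(f,u)⟩ = (F/(V·2πn))·(νκ² Λ⟨(Ψ_s,u)⟩ − Λ⟨T_s(w)⟩). Proof plan (~400
lines): test the weak formulation with the steady div-free fields Ψ_c = sin cos e₀ and Ψ_s = sin sin
e₀ (IsLerayHopfOn.integral_inner_eq_add_setIntegral as in
AlexakisDoeringProofs.amplitude_mul_eq_of_isGlobalLerayHopf; momentum conservation
Torus.IsGlobalLerayHopf.integral_inner_const_eq): with A = (u,Ψ_c), B = (u,Ψ_s), V∂₂Ψ_c = −2πnV Ψ_s,
V∂₂Ψ_s = 2πnV Ψ_c, ΔΨ = −κ²Ψ, (f,Ψ_c) = F/4, (f,Ψ_s) = 0: B is absolutely continuous with B' =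
T_s(w) + 2πnV A − νκ²B; Cesàro-average, boundary terms o(1) by the sup-energy bound, apply Λ
(linear, kills null sequences): 2πnV Λ⟨A⟩ = νκ²Λ⟨B⟩ − Λ⟨T_s⟩; injection (f,u) = F·A. [difficulty:
provable-now] -/
@[route_item "route-AnomalousDissipation-DopplerClock", crux]
def DopplerWorkIdentity : Prop :=
  ∀ (Λ : Literature.Analysis.FluidPDE.GeneralizedLimit) (F V ν : ℝ) (m n : ℕ) (u₀ : UnitAddTorus (Fin 3) → EuclideanSpace ℝ (Fin 3)) (u : ℝ → UnitAddTorus (Fin 3) → EuclideanSpace ℝ (Fin 3)), 0 < V → 0 < ν → 0 < n → Literature.Analysis.FluidPDE.Torus.IsGlobalLerayHopf ν (fun _ => (fun (x : UnitAddTorus (Fin 3)) => (F * (UnitAddTorus.mFourier (Pi.single (1 : Fin 3) (m : ℤ)) x).im * (UnitAddTorus.mFourier (Pi.single (2 : Fin 3) (n : ℤ)) x).re) • EuclideanSpace.single (0 : Fin 3) (1 : ℝ))) u₀ u → (∫ x, u₀ x = V • EuclideanSpace.single (2 : Fin 3) (1 : ℝ)) → (∃ C : ℝ, ∀ t : ℝ,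 0 ≤ t → Literature.Analysis.FunctionSpaces.Torus.kineticEnergy (u t) ≤ C) → Λ.longTimeAvg (fun t => ∫ x, inner ℝ ((F * (UnitAddTorus.mFourier (Pi.single (1 : Fin 3) (m : ℤ)) x).im * (UnitAddTorus.mFourier (Pi.single (2 : Fin 3) (n : ℤ)) x).re) • EuclideanSpace.single (0 : Fin 3) (1 : ℝ)) (u t x)) = F / (V * (2 * Real.pi * n)) * (ν * ((2 * Real.pi) ^ 2 * ((m : ℝ) ^ 2 + (n : ℝ) ^ 2)) * Λ.longTimeAvg (fun t => ∫ x, inner ℝ (((UnitAddTorus.mFourier (Pi.single (1 : Fin 3) (m : ℤ)) x).im * (UnitAddTorus.mFourier (Pi.single (2 : Fin 3) (n : ℤ)) x).im) • EuclideanSpace.single (0 : Fin 3) (1 : ℝ)) (u t x)) - Λ.longTimeAvg (fun t => ∫ x, inner ℝ (u t x - V • EuclideanSpace.single (2 : Fin 3) (1 : ℝ)) (Literature.Analysis.FunctionSpaces.Torus.convect (fun y => u t y - V • EuclideanSpace.single (2 : Fin 3) (1 : ℝ)) (fun (y : UnitAddTorus (Fin 3)) => ((UnitAddTorus.mFourier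 (Pi.single (1 : Fin 3) (m : ℤ)) y).im * (UnitAddTorus.mFourier (Pi.single (2 : Fin 3) (n : ℤ)) y).im) • EuclideanSpace.single (0 : Fin 3) (1 : ℝ)) x)))

/-- item stmt-AnomalousDissipation-18134 · support · rank 9 · closed · proved by Summit.AnomalousDissipation.AnomalousDissipation.Theorems.longitudinalClassQuiet_proof @ 7fb19587718b (prover) · by planner
sources: AlexakisDoering2006PLA, Marchioro1986, BardosTitiWiedemann2012
[support] DESIGN RULE (ClockedKolmogorov's PlanarStageBound, now structural): the only
translation-invariant sub-dynamics of this force is x₀-invariance (d·∇ curl f ≡ 0 forces d ∥ e₀ when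
F ≠ 0, m, n ≥ 1; x₁- or x₂-invariant solutions do not exist), and it is QUIET: every x₀-invariant
classical solution on [0,∞) with momentum V e₂ and bounded energy has meanDissipation ≤
νκ²F²/(4V²(2πn)²) (= the laminar bound). Proof plan: the cross-plane field (u₁,u₂)(t,x₁,x₂) solves
UNFORCED 2-D Navier–Stokes, hence → V e₂ exponentially with ∫₀^∞‖∇v‖² < ∞; u₀ is a forced scalar
advected by it and relaxes to the laminar streaks in L² with square-integrable gradient error;
Cesàro means inherit the laminar values. ~600 lines. [difficulty: M] -/
@[route_item "route-AnomalousDissipation-DopplerClock"]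
def LongitudinalClassQuiet : Prop :=
  ∀ (F V ν : ℝ) (m n : ℕ) (u : ℝ → UnitAddTorus (Fin 3) → EuclideanSpace ℝ (Fin 3)) (p : ℝ → UnitAddTorus (Fin 3) → ℝ), 0 < V → 0 < ν → 0 < n → Literature.Analysis.FunctionSpaces.Torus.IsClassicalNSSolutionOn (Set.Ici 0) ν (fun _ => (fun (x : UnitAddTorus (Fin 3)) => (F * (UnitAddTorus.mFourier (Pi.single (1 : Fin 3) (m : ℤ)) x).im * (UnitAddTorus.mFourier (Pi.single (2 : Fin 3) (n : ℤ)) x).re) • EuclideanSpace.single (0 : Fin 3) (1 : ℝ))) u p → (∀ (t : ℝ) (c : UnitAddCircle) (x : UnitAddTorus (Fin 3)), u t (x + Pi.single (0 : Fin 3) c) = u t x) → (∫ x, u 0 x = V • EuclideanSpace.single (2 : Fin 3) (1 : ℝ)) → (∃ C : ℝ, ∀ t : ℝ, 0 ≤ t → Literature.Analysis.FunctionSpaces.Torus.kineticEnergy (u t) ≤ C) → Literature.Analysis.FluidPDE.meanDissipation ν u ≤ ν * ((2 * Real.pi) ^ 2 * ((m : ℝ) ^ 2 + (n : ℝ) ^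 2)) * F ^ 2 / (4 * V ^ 2 * (2 * Real.pi * n) ^ 2)

/-- item stmt-AnomalousDissipation-18135 · support · rank 9 · closed · proved by Summit.AnomalousDissipation.AnomalousDissipation.Theorems.dopplerClockCruxesGiveTarget_proof @ f248a1137713 (prover) · by planner
sources: FoiasManleyRosaTemam2001, DoeringFoias2002
[support] GLUE C1 → C2 → DopplerWorkIdentity → X (~300 lines of limsup/Banach-mean bookkeeping):
take F,V,m,n,Λ and the family from C1; C2 gives E_j := meanEnergy(u_j) ≤ C(1 + W̄_j) with W̄_j =
limsup-mean (f,u_j) ≤ (F/2)·√E_j (Cauchy–Schwarz in space, Jensen in time, ‖f‖₂ = F/2), so E_j ≤ E*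
uniformly (quadratic inequality); the identity gives Λ⟨(f,u_j)⟩ ≥ (F/2πnV)(ε₀ − ν_jκ²|Λ⟨B_j⟩|) with
|Λ⟨B_j⟩| ≤ ½√E* (GeneralizedLimit.le_limsup / liminf_le, ‖Ψ_s‖₂ = ½), hence ≥ ε := Fε₀/(4πnV) for j
≥ J; no-leak and Λ ≤ limsup give meanDissipation ≥ ε for j ≥ J; reindex j ↦ j + J
(Filter.tendsto_add_atTop_iff_nat). [difficulty: provable-now] -/
@[route_item "route-AnomalousDissipation-DopplerClock", crux]
def CruxesGiveTarget : Prop :=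
  QuadratureStressFloor → InjectionControlsEnergy → DopplerWorkIdentity → DopplerZerothLaw

/-- item stmt-AnomalousDissipation-18136 · assembly · rank 1 · closed · proved by Summit.AnomalousDissipation.AnomalousDissipation.Theorems.dopplerClockAssembly_proof @ f3609b422824 (prover) · by planner
sources: BrueDeLellis2023, Cheskidov2023
[assembly] QuadratureStressFloor → InjectionControlsEnergy → DopplerWorkIdentity → ForceAdmissible →
CruxesGiveTarget → AnomalousDissipation. -/
@[route_item "route-AnomalousDissipation-DopplerClock"]
def Assembly : Prop :=
  QuadratureStressFloor → InjectionControlsEnergy → DopplerWorkIdentity → ForceAdmissible → CruxesGiveTarget → AnomalousDissipation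

/-! D-0027 §2.1 — DECIDING THEOREM (planner-authored via `route open/edit --closes-file`; by planner-plan-lens3-AnomalousDissipation-resurrect-0 2026-08-17T02:21:39Z):
its hypotheses are this route's items and its conclusion the sub-problem Statement (glue_lint), and it elaborates with this file. -/

@[closes "route-AnomalousDissipation-DopplerClock"] theorem closes : QuadratureStressFloor → InjectionControlsEnergy → DopplerWorkIdentity → ForceAdmissible → CruxesGiveTarget → _root_.AnomalousDissipation := by
  intro h₁ h₂ hI hA hG
  obtain ⟨F, V, m, n, hF, hV, hm, hn, ν, u₀, u, hν, hν0, hLH, _hmom, hE, ε, hε, hεu⟩ := hG h₁ h₂ hI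
  obtain ⟨hs, hd, hz⟩ := hA F m n
  exact ⟨_, hs, hd, hz, ν, u₀, u, hν, hν0, hLH, hE, ε, hε, hεu⟩

end Summit.AnomalousDissipation.AnomalousDissipation.Theses.DopplerClock
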